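import Summits.MatrixMultiplication.MatrixMultiplication.Theses.OctonionicLaser
import Summits.MatrixMultiplication.MatrixMultiplication.Theorems.OctonionicLaserDefs
import Literature.Computability.AlgebraicComplexity.AsymptoticSpectrumDuality
import Literature.Computability.AlgebraicComplexity.StrassenSpectralTheorem
import Literature.Computability.AlgebraicComplexity.DegenerationSpectralMonotone
import Literature.Computability.AlgebraicComplexity.AsymptoticRankMatMul
import Summits.MatrixMultiplication.MatrixMultiplication.Theorems.OctonionicLaserOctSpectralDominanceAsymptoticForm
import HarnessLib

/-!
# Route OctonionicLaser — crux `OctSpectralDominance` (stmt-MatrixMultiplication-7931): the block family is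
# EQUIVALENT to the crux (converse of `stub_octDominanceOfBlockFamily`)

`Theorems/OctonionicLaserOctSpectralDominanceAsymptoticForm.lean` proves `OctSpectralDominance ↔ 2·[⟨2,2,2⟩] ≲ [t₈]`
(Strassen's spectral theorem on `T(ℂ)`) and that the block family
`∀ ε > 0 ∃ k ≥ 1, j, m, (2−ε)^k ≤ m ∧ (1−ε)k ≤ j ∧ t₈^{⊠k} ⊵ ⟨m⟩ ⊗ ⟨2^j,2^j,2^j⟩` implies the crux.  Here the
converse: the crux implies the block family — indeed with RESTRICTIONS, full blocks `j = N` and `m = 2^N` at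
level `k = N + N'`, `N' = o(N)`: from `(2·[⟨2,2,2⟩])^N ≤ f(N)·[t₈]^N` (`f` subexponential) and
`[t₈]^{N'} ≥ [⟨2,2,2⟩]^{N'} ≥ 2^{N'} ≥ f(N)` one gets `2^N·[⟨2^N,2^N,2^N⟩] = (2[⟨2,2,2⟩])^N ≤ [t₈]^{N+N'}`.
So the registered stub S `stub_octBlockFamily` of the crux skeleton is an honest reformulation of (ii), not a
strengthening.

* `restrictsTo_blocks_of_le` (the algebraic step), `octBlockFamily_of_asympLe`,
  `octBlockFamily_of_octSpectralDominance`, `octSpectralDominance_iff_blockFamily`, and the registered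
  consequence stub `stub_octBlockFamilyOfDominance` ((ii) ⟹ block family, route's inline terms).

## References

* [Zuiddam2018] J. Zuiddam, PhD thesis (Amsterdam 2018), Def. 2.1, Thm. 2.12.
* [Strassen1988] V. Strassen, J. reine angew. Math. 384 (1988), §3.
* [AlmanDuanVassilevskaWilliamsXuXuZhou2025] J. Alman et al., SODA 2025, §3.4 (`⟨q,q,q⟩^{⊗n} ≡ ⟨qⁿ,qⁿ,qⁿ⟩`).
-/

noncomputable section

set_option linter.dupNamespace false

namespace Summit.MatrixMultiplication.MatrixMultiplication.Theorems

open Literature.Computability.AlgebraicComplexity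
open Summit.MatrixMultiplication.MatrixMultiplication.Theses.OctonionicLaser (OctSpectralDominance)
open OctonionicLaser (octT)

/-! ## Small facts in `T(ℂ)` -/

/-- `[⟨2,2,2⟩] ≤ [t₈]`: block `(0;0,0)` of the octonion tensor is the `2 × 2` matrix product (restriction along
the inclusion of the degree-`0` indices). [folklore] -/
theorem mk_matMulTensor_two_le_mk_octT :
    TensorClass.mk (matMulTensor ℂ 2 2 2) ≤ TensorClass.mk (octT ℂ) := by
  rw [TensorClass.mk_le_mk_iff]
  have key : matMulTensor ℂ 2 2 2 =
      fun u v w : Fin 2 × Fin 2 => octT ℂ ((0 : Fin 2), u) ((0 : Fin 2), v) ((0 : Fin 2), w) := by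
    funext u v w
    simp only [octT, true_and, if_true, Fin.isValue, zero_ne_one, false_and, and_false,
      if_false, sub_zero, add_zero]
    simp only [matMulTensor, Matrix.mul_apply, Matrix.single_apply, Fin.sum_univ_two, Fin.isValue]
    rcases u with ⟨u1, u2⟩; rcases v with ⟨v1, v2⟩; rcases w with ⟨w1, w2⟩
    fin_cases u1 <;> fin_cases u2 <;> fin_cases v1 <;> fin_cases v2 <;> fin_cases w1 <;> fin_cases w2 <;>
      simp
  rw [key]
  exact tensorRestrictsTo_precomp _ _ _ _

/-- `2 ≤ [⟨2,2,2⟩]` in `T(ℂ)`: the diagonal `⟨2⟩` is the restriction of `⟨2,2,2⟩` to the diagonal matrix units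
`E₀₀, E₁₁` on all three legs. [folklore] -/
theorem two_le_mk_matMulTensor_two : (2 : TensorClass ℂ) ≤ TensorClass.mk (matMulTensor ℂ 2 2 2) := by
  rw [tensorClass_two_eq_mk, TensorClass.mk_le_mk_iff]
  have key : unitTensor ℂ 2 = fun a b c : Fin 2 => matMulTensor ℂ 2 2 2 (a, a) (b, b) (c, c) := by
    funext a b c
    simp only [unitTensor, matMulTensor]
    fin_cases a <;> fin_cases b <;> fin_cases c <;> simp
  rw [key]
  exact tensorRestrictsTo_precomp _ _ _ _

/-- `[⟨2,2,2⟩]^N = [⟨2^N,2^N,2^N⟩]` in `T(ℂ)` (Kronecker powers of a matrix product are the big matrix product, up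
to relabelling). [cite: AlmanDuanVassilevskaWilliamsXuXuZhou2025, §3.4] -/
theorem mk_matMulTensor_two_pow (N : ℕ) :
    TensorClass.mk (matMulTensor ℂ 2 2 2) ^ N = TensorClass.mk (matMulTensor ℂ (2 ^ N) (2 ^ N) (2 ^ N)) := by
  rw [TensorClass.mk_pow, kroneckerPow_matMulTensor_eq_comp ℂ 2 2 2 N]
  let e : (Fin N → Fin 2 × Fin 2) ≃ Fin (2 ^ N) × Fin (2 ^ N) :=
    { toFun := fun a => (finFunctionFinEquiv (fun i => (a i).1), finFunctionFinEquiv (fun i => (a i).2))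
      invFun := fun p i => (finFunctionFinEquiv.symm p.1 i, finFunctionFinEquiv.symm p.2 i)
      left_inv := fun a => by
        funext i
        simp only [Equiv.symm_apply_apply, Prod.mk.eta]
      right_inv := fun p => by
        rcases p with ⟨p1, p2⟩
        simp only [Equiv.apply_symm_apply] }
  exact TensorClass.mk_reindex (K := ℂ) (matMulTensor ℂ (2 ^ N) (2 ^ N) (2 ^ N)) e e e

/-! ## The algebraic step in `T(ℂ)` -/

/-- If `(2·[⟨2,2,2⟩])^N ≤ f(N)·[t₈]^N` and `f(N) ≤ 2^{N'}`, then `⟨2^N⟩ ⊗ ⟨2^N,2^N,2^N⟩` is a restriction of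
`t₈^{⊠(N + N')}` (absorb `f(N) ≤ 2^{N'} ≤ [⟨2,2,2⟩]^{N'} ≤ [t₈]^{N'}`). [folklore] -/
theorem restrictsTo_blocks_of_le {f : ℕ → ℕ} {N N' : ℕ}
    (hle : (2 * TensorClass.mk (matMulTensor ℂ 2 2 2)) ^ N ≤
      (f N : TensorClass ℂ) * TensorClass.mk (octT ℂ) ^ N)
    (hf : f N ≤ 2 ^ N') :
    TensorRestrictsTo (kroneckerPow (octT ℂ) (N + N'))
      (kroneckerTensor (unitTensor ℂ (2 ^ N)) (matMulTensor ℂ (2 ^ N) (2 ^ N) (2 ^ N))) := by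
  have hS := TensorClass.isStrassenPreorder ℂ
  set a : TensorClass ℂ := TensorClass.mk (matMulTensor ℂ 2 2 2) with ha
  set b : TensorClass ℂ := TensorClass.mk (octT ℂ) with hb
  have hab : a ≤ b := mk_matMulTensor_two_le_mk_octT
  have h2a : (2 : TensorClass ℂ) ≤ a := two_le_mk_matMulTensor_two
  -- `f N ≤ 2^{N'} ≤ a^{N'} ≤ b^{N'}`
  have hfN : (f N : TensorClass ℂ) ≤ b ^ N' := by
    calc (f N : TensorClass ℂ) ≤ ((2 ^ N' : ℕ) : TensorClass ℂ) :=
          TensorClass.natCast_le_natCast_iff.2 hf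
      _ = (2 : TensorClass ℂ) ^ N' := by push_cast; rfl
      _ ≤ a ^ N' := hS.pow_le_pow h2a N'
      _ ≤ b ^ N' := hS.pow_le_pow hab N'
  have key : (2 * a) ^ N ≤ b ^ (N + N') := by
    calc (2 * a) ^ N ≤ (f N : TensorClass ℂ) * b ^ N := hle
      _ ≤ b ^ N' * b ^ N := TensorClass.mul_le_mul hfN le_rfl
      _ = b ^ (N + N') := by rw [← pow_add, add_comm]
  -- read the two sides as tensors
  have hl : (2 * a) ^ N = TensorClass.mk (kroneckerTensor (unitTensor ℂ (2 ^ N))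
      (matMulTensor ℂ (2 ^ N) (2 ^ N) (2 ^ N))) := by
    rw [mul_pow, ha, mk_matMulTensor_two_pow, ← TensorClass.mk_mul_mk, ← TensorClass.natCast_eq_mk]
    push_cast; rfl
  have hr : b ^ (N + N') = TensorClass.mk (kroneckerPow (octT ℂ) (N + N')) := by
    rw [hb, TensorClass.mk_pow]
  rw [hl, hr] at key
  exact TensorClass.mk_le_mk_iff.1 key

/-! ## The numerical bookkeeping -/

/-- `1 - x ≤ 2^{-x}` for `0 ≤ x` (`2^{-x} = e^{-x log 2} ≥ 1 - x log 2 ≥ 1 - x`). [folklore] -/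
theorem one_sub_le_two_rpow_neg {x : ℝ} (hx : 0 ≤ x) : 1 - x ≤ (2 : ℝ) ^ (-x) := by
  have hlog2 : Real.log 2 ≤ 1 := by
    have := Real.log_le_sub_one_of_pos (x := 2) two_pos
    linarith
  have h1 : 1 - x ≤ 1 - x * Real.log 2 := by nlinarith [Real.log_pos one_lt_two]
  have h2 : -(x * Real.log 2) + 1 ≤ Real.exp (-(x * Real.log 2)) := Real.add_one_le_exp _
  rw [Real.rpow_def_of_pos two_pos]
  have h3 : Real.log 2 * -x = -(x * Real.log 2) := by ring
  rw [h3]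
  linarith

/-- **Bookkeeping for the converse**: for `0 < ε < 1`, `θ = ε/4`, naturals `N₁, N, N'` with `N₁ + 1 ≤ θ N` and
`N' ≤ N₁ + θ N + 1`: `(2 − ε)^{N+N'} ≤ 2^N` and `(1 − ε)(N + N') ≤ N`. [folklore] -/
theorem converse_bookkeeping {ε : ℝ} (hε : 0 < ε) (hε1 : ε < 1) {N₁ N N' : ℕ}
    (hN : (N₁ : ℝ) + 1 ≤ ε / 4 * N) (hN' : (N' : ℝ) ≤ N₁ + ε / 4 * N + 1) :
    ((2 : ℝ) - ε) ^ (N + N') ≤ (2 : ℝ) ^ N ∧ (1 - ε) * ((N + N' : ℕ) : ℝ) ≤ N := by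
  have hN0 : (0 : ℝ) ≤ N := Nat.cast_nonneg N
  have hN'0 : (0 : ℝ) ≤ N' := Nat.cast_nonneg N'
  refine ⟨?_, ?_⟩
  · -- `(2-ε)^{N+N'} = (2-ε)^N (2-ε)^{N'} ≤ (2^N (1-ε/2)^N) · 2^{N'}` and `(1-ε/2)^N 2^{N'} ≤ 1`
    have h2e0 : (0 : ℝ) ≤ 2 - ε := by linarith
    have hA : ((2 : ℝ) - ε) ^ N' ≤ (2 : ℝ) ^ N' := pow_le_pow_left₀ h2e0 (by linarith) N'
    have hB : ((2 : ℝ) - ε) ^ N = (2 : ℝ) ^ N * (1 - ε / 2) ^ N := by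
      rw [← mul_pow]; congr 1; ring
    -- `(1 - ε/2)^N ≤ 2^{-(ε/2) N}`
    have hC : (1 - ε / 2) ^ N ≤ (2 : ℝ) ^ (-(ε / 2) * N) := by
      have h1 : (1 - ε / 2) ^ N ≤ ((2 : ℝ) ^ (-(ε / 2))) ^ N :=
        pow_le_pow_left₀ (by linarith) (one_sub_le_two_rpow_neg (by linarith)) N
      rwa [← Real.rpow_natCast ((2 : ℝ) ^ (-(ε / 2))) N, ← Real.rpow_mul zero_le_two] at h1
    -- `2^{N'} ≤ 2^{N₁ + θN + 1}`
    have hD : (2 : ℝ) ^ N' ≤ (2 : ℝ) ^ ((N₁ : ℝ) + ε / 4 * N + 1) := by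
      rw [← Real.rpow_natCast (2 : ℝ) N']
      exact Real.rpow_le_rpow_of_exponent_le one_le_two hN'
    -- combine exponents
    have hE : (2 : ℝ) ^ (-(ε / 2) * N) * (2 : ℝ) ^ ((N₁ : ℝ) + ε / 4 * N + 1) ≤ 1 := by
      rw [← Real.rpow_add two_pos]
      have hexp : -(ε / 2) * (N : ℝ) + ((N₁ : ℝ) + ε / 4 * N + 1) ≤ 0 := by nlinarith
      calc (2 : ℝ) ^ (-(ε / 2) * (N : ℝ) + ((N₁ : ℝ) + ε / 4 * N + 1))
          ≤ (2 : ℝ) ^ (0 : ℝ) := Real.rpow_le_rpow_of_exponent_le one_le_two hexp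
        _ = 1 := Real.rpow_zero 2
    have h2N : (0 : ℝ) ≤ (2 : ℝ) ^ N := by positivity
    have hCpos : (0 : ℝ) ≤ (1 - ε / 2) ^ N := pow_nonneg (by linarith) N
    calc ((2 : ℝ) - ε) ^ (N + N') = ((2 : ℝ) - ε) ^ N * ((2 : ℝ) - ε) ^ N' := pow_add _ _ _
      _ ≤ ((2 : ℝ) ^ N * (1 - ε / 2) ^ N) * (2 : ℝ) ^ N' := by
          rw [hB]; exact mul_le_mul_of_nonneg_left hA (mul_nonneg h2N hCpos)
      _ = (2 : ℝ) ^ N * ((1 - ε / 2) ^ N * (2 : ℝ) ^ N') := by ring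
      _ ≤ (2 : ℝ) ^ N * ((2 : ℝ) ^ (-(ε / 2) * N) * (2 : ℝ) ^ ((N₁ : ℝ) + ε / 4 * N + 1)) := by
          refine mul_le_mul_of_nonneg_left ?_ h2N
          exact mul_le_mul hC hD (by positivity) (Real.rpow_nonneg zero_le_two _)
      _ ≤ (2 : ℝ) ^ N * 1 := mul_le_mul_of_nonneg_left hE h2N
      _ = (2 : ℝ) ^ N := mul_one _
  · push_cast
    nlinarith

/-! ## The converse -/

/-- **`2·[⟨2,2,2⟩] ≲ [t₈]` implies the block family** — with restrictions and full-size blocks: for every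
`ε > 0` there are `k ≥ 1`, `j`, `m` with `(2−ε)^k ≤ m`, `(1−ε)k ≤ j` and `t₈^{⊠k} ⊵ ⟨m⟩ ⊗ ⟨2^j,2^j,2^j⟩`
(indeed `k = N + o(N)`, `j = N`, `m = 2^N`). [cite: Zuiddam2018, Def. 2.1] -/
theorem octBlockFamily_of_asympLe
    (h : AsympLe (fun x y : TensorClass ℂ => x ≤ y) (2 * TensorClass.mk (matMulTensor ℂ 2 2 2))
      (TensorClass.mk (octT ℂ))) :
    ∀ ε : ℝ, 0 < ε → ∃ k j m : ℕ, 1 ≤ k ∧ ((2 : ℝ) - ε) ^ k ≤ m ∧ (1 - ε) * k ≤ j ∧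
      AlgDegeneratesTo (kroneckerPow (octT ℂ) k)
        (kroneckerTensor (unitTensor ℂ m) (matMulTensor ℂ (2 ^ j) (2 ^ j) (2 ^ j))) := by
  obtain ⟨f, hf, hle⟩ := h
  intro ε hε
  by_cases hε1 : 1 ≤ ε
  · -- trivial range `ε ≥ 1`: one block of size `1` at level `1` (`t₈ ≥ ⟨1⟩`)
    refine ⟨0 + 1, 0, 2 ^ 0, by omega, ?_, ?_, ?_⟩
    · simp only [zero_add, pow_one, pow_zero, Nat.cast_one]; linarith
    · simp only [zero_add, Nat.cast_one, mul_one, Nat.cast_zero]; linarith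
    · refine (restrictsTo_blocks_of_le (f := fun _ => 1) (N := 0) (N' := 1) ?_ ?_).algDegeneratesTo
      · simp
      · norm_num
  · push Not at hε1
    -- subexponential bound with ratio `2^{ε/4}`
    set θ : ℝ := ε / 4 with hθ
    have hθ0 : 0 < θ := by rw [hθ]; linarith
    have hδ : 0 < (2 : ℝ) ^ θ - 1 := by
      have : (1 : ℝ) < (2 : ℝ) ^ θ := Real.one_lt_rpow one_lt_two hθ0
      linarith
    obtain ⟨C, hC⟩ := hf ((2 : ℝ) ^ θ - 1) hδ
    have hC' : ∀ n : ℕ, (f n : ℝ) ≤ C * (2 : ℝ) ^ (θ * n) := by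
      intro n
      have := hC n
      rwa [add_sub_cancel, ← Real.rpow_natCast ((2 : ℝ) ^ θ) n, ← Real.rpow_mul zero_le_two] at this
    obtain ⟨N₁, hN₁⟩ := pow_unbounded_of_one_lt C one_lt_two
    -- the level
    set N : ℕ := ⌈4 * ((N₁ : ℝ) + 1) / ε⌉₊ + 1 with hNdef
    set N' : ℕ := N₁ + ⌈θ * N⌉₊ with hN'def
    have hN1 : 1 ≤ N := by rw [hNdef]; omega
    have hNreal : (N₁ : ℝ) + 1 ≤ ε / 4 * N := by
      have h1 : 4 * ((N₁ : ℝ) + 1) / ε ≤ ⌈4 * ((N₁ : ℝ) + 1) / ε⌉₊ := Nat.le_ceil _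
      have h2 : (N : ℝ) = (⌈4 * ((N₁ : ℝ) + 1) / ε⌉₊ : ℝ) + 1 := by rw [hNdef]; push_cast; ring
      have h3 : 4 * ((N₁ : ℝ) + 1) / ε * (ε / 4) = (N₁ : ℝ) + 1 := by field_simp
      nlinarith
    have hN'real : (N' : ℝ) ≤ N₁ + ε / 4 * N + 1 := by
      have h1 : (⌈θ * (N : ℝ)⌉₊ : ℝ) < θ * N + 1 := Nat.ceil_lt_add_one (by positivity)
      have h2 : (N' : ℝ) = N₁ + (⌈θ * (N : ℝ)⌉₊ : ℝ) := by rw [hN'def]; push_cast; ring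
      rw [h2, hθ] at *
      linarith
    -- `f N ≤ 2^{N'}`
    have hfN : f N ≤ 2 ^ N' := by
      have h1 : (f N : ℝ) ≤ C * (2 : ℝ) ^ (θ * N) := hC' N
      have h2 : C * (2 : ℝ) ^ (θ * N) ≤ (2 : ℝ) ^ N₁ * (2 : ℝ) ^ (⌈θ * (N : ℝ)⌉₊ : ℝ) := by
        refine mul_le_mul hN₁.le ?_ (Real.rpow_nonneg zero_le_two _) (by positivity)
        exact Real.rpow_le_rpow_of_exponent_le one_le_two (Nat.le_ceil _)
      have h3 : (2 : ℝ) ^ N₁ * (2 : ℝ) ^ (⌈θ * (N : ℝ)⌉₊ : ℝ) = ((2 ^ N' : ℕ) : ℝ) := by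
        rw [Real.rpow_natCast, hN'def]; push_cast; rw [pow_add]
      exact_mod_cast (h1.trans (h3 ▸ h2))
    obtain ⟨hk, hj⟩ := converse_bookkeeping hε hε1 hNreal hN'real
    refine ⟨N + N', N, 2 ^ N, by omega, by exact_mod_cast hk, hj, ?_⟩
    exact (restrictsTo_blocks_of_le (hle N) hfN).algDegeneratesTo

/-- **The crux implies the block family.** [cite: Zuiddam2018, Thm. 2.12] -/
theorem octBlockFamily_of_octSpectralDominance (h : OctSpectralDominance) :
    ∀ ε : ℝ, 0 < ε → ∃ k j m : ℕ, 1 ≤ k ∧ ((2 : ℝ) - ε) ^ k ≤ m ∧ (1 - ε) * k ≤ j ∧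
      AlgDegeneratesTo (kroneckerPow (octT ℂ) k)
        (kroneckerTensor (unitTensor ℂ m) (matMulTensor ℂ (2 ^ j) (2 ^ j) (2 ^ j))) :=
  octBlockFamily_of_asympLe (octSpectralDominance_iff_asympLe.1 h)

/-- **Crux (ii) ⟺ the block family** (`stub_octBlockFamily` of the crux skeleton is an equivalent
reformulation of `OctSpectralDominance`). [cite: Zuiddam2018, Thm. 2.12] -/
theorem octSpectralDominance_iff_blockFamily :
    OctSpectralDominance ↔
      ∀ ε : ℝ, 0 < ε → ∃ k j m : ℕ, 1 ≤ k ∧ ((2 : ℝ) - ε) ^ k ≤ m ∧ (1 - ε) * k ≤ j ∧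
        AlgDegeneratesTo (kroneckerPow (octT ℂ) k)
          (kroneckerTensor (unitTensor ℂ m) (matMulTensor ℂ (2 ^ j) (2 ^ j) (2 ^ j))) :=
  ⟨octBlockFamily_of_octSpectralDominance, octSpectralDominance_of_blockFamily⟩

/-- **Stub `stub_octBlockFamilyOfDominance` of the crux skeleton of `OctSpectralDominance`
(stmt-MatrixMultiplication-7931, line `registered`)**: (ii) ⟹ the block family, route's inline terms
(consequence stub; with `stub_octDominanceOfBlockFamily` it makes stub S equivalent to the crux).
[cite: Zuiddam2018, Thm. 2.12] -/
theorem stub_octBlockFamilyOfDominance : (∀ F : SpectralMap ℂ, IsUniversalSpectralPoint ℂ F → 2 * F (matMulTensor ℂ 2 2 2) ≤ F (fun o p q : Fin 2 × Fin 2 × Fin 2 => (if o.1 = 0 ∧ p.1 = 0 ∧ q.1 = 0 then (Matrix.single p.2.1 p.2.2 (1:ℂ) * Matrix.single q.2.1 q.2.2 (1:ℂ)) o.2.1 o.2.2 else 0) - (if o.1 = 0 ∧ p.1 = 1 ∧ q.1 = 1 then ((Matrix.single q.2.1 q.2.2 (1:ℂ)).adjugate * Matrix.single p.2.1 p.2.2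 (1:ℂ)) o.2.1 o.2.2 else 0) + (if o.1 = 1 ∧ p.1 = 0 ∧ q.1 = 1 then (Matrix.single q.2.1 q.2.2 (1:ℂ) * Matrix.single p.2.1 p.2.2 (1:ℂ)) o.2.1 o.2.2 else 0) + (if o.1 = 1 ∧ p.1 = 1 ∧ q.1 = 0 then (Matrix.single p.2.1 p.2.2 (1:ℂ) * (Matrix.single q.2.1 q.2.2 (1:ℂ)).adjugate) o.2.1 o.2.2 else 0))) → ∀ ε : ℝ, 0 < ε → ∃ k j m : ℕ, 1 ≤ k ∧ ((2 : ℝ) - ε) ^ k ≤ m ∧ (1 - ε) * k ≤ j ∧ AlgDegeneratesTo (kroneckerPow (fun o p q : Fin 2 × Fin 2 × Fin 2 => (if o.1 = 0 ∧ p.1 = 0 ∧ q.1 = 0 then (Matrix.single p.2.1 p.2.2 (1:ℂ) * Matrix.single q.2.1 q.2.2 (1:ℂ)) o.2.1 o.2.2 else 0) - (if o.1 = 0 ∧ p.1 = 1 ∧ q.1 = 1 then ((Matrix.single q.2.1 q.2.2 (1:ℂ)).adjugate * Matrix.single p.2.1 p.2.2 (1:ℂ)) o.2.1 o.2.2 else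 0) + (if o.1 = 1 ∧ p.1 = 0 ∧ q.1 = 1 then (Matrix.single q.2.1 q.2.2 (1:ℂ) * Matrix.single p.2.1 p.2.2 (1:ℂ)) o.2.1 o.2.2 else 0) + (if o.1 = 1 ∧ p.1 = 1 ∧ q.1 = 0 then (Matrix.single p.2.1 p.2.2 (1:ℂ) * (Matrix.single q.2.1 q.2.2 (1:ℂ)).adjugate) o.2.1 o.2.2 else 0)) k) (kroneckerTensor (unitTensor ℂ m) (matMulTensor ℂ (2 ^ j) (2 ^ j) (2 ^ j))) :=
  octBlockFamily_of_octSpectralDominance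

end Summit.MatrixMultiplication.MatrixMultiplication.Theorems

end
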